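import Summits.QuantumFields.YangMills.Theorems.AlphaInputsT3ACv3StartCert
import Summits.QuantumFields.YangMills.Theorems.AlphaInputsT3ACv3StartSepKnit
import Summits.QuantumFields.YangMills.Theorems.AlphaInputsT3ACv3StartOmegaSat
import Summits.QuantumFields.YangMills.Theorems.AlphaInputsT3ACv3StartS6Numerals
import HarnessLib

/-!
# `AlphaInputsT3ACv3StartCertKnit` — START v3.1 for the (FL) `hLift` binder: **THE START CERTIFICATE AT `Ω_{k+1}(h)` WITH THE LATTICE BINDERS KNITTED IN** — `startT3_cert` at the binder's
# region `Ω := Omega M₁ Rcol (k+1) h (k+1)` on the three-torus (`(F.P K).d = 3`: the longitudinal direction `thirdDir`), with `hbox`∕`hcov`∕`hbox_sh`∕`hcov_sh` (★w2's lattice theorems via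
# `…StartLatticeKnit`), `htwo` (`htwo_of_sat`) and all saturation rows (`omega_sat`∕`omega_sat1`, `mem_Omega_iff_of_coarsen_eq`, `coarsen_toFine`) DISCHARGED, and `hsep`∕`hsep_sh` (★w5's `hsep_startSys`∕`hsep_of_corners` via `…StartSepKnit`): ★★★ `startT3_cert_omega`
# and the (S6) rows by ★w2 g3's `S6rows_of_le` displays NO lattice binder and NO (S6) row — only the numeral windows `ε′ ≤ 10⁻⁵`, `10²²·L·ε′ ≤ 1` — lane `pub-balaban3d` ∕ cell `ym3-torus`, seat `ym-ust-19936-w1` (g2, LEAD)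

WHY (M22 START side; OWNER g25 closing rule: LEAD rules inside (FL)∕START).
WHAT IS HERE: `thirdDir`, `thirdDir_spec` (d = 3 bookkeeping), `hwin_of_dist1`, ★★★`startT3_cert_omega`.
HONEST FRAMING.  Knit; the L-dependent numeral window `10²²·L·ε′ ≤ 1` displayed (absorbed by `B₀(L)`, FL-SMALL (c′)); (FL)∕`hLift` NOT proved; count-neutral helper toward R3 2′ (items 19936∕19935); registry untouched; nothing about
d = 4, the continuum, or a mass gap; YM₃ on T³ is rung R3, not Clay.

References: T. Bałaban, Commun. Math. Phys. 102 (1985) 277–309 [Balaban1985Variational] (Thm 1 (8) p.279, (11)–(15) pp.279–280); Commun. Math. Phys. 102 (1985) 255–275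
[Balaban1985UV3] ((38)–(42) p.266).
-/

set_option autoImplicit false

noncomputable section

open scoped Matrix.Norms.L2Operator

namespace Summit.QuantumFields.YangMills.Theorems.TubeStart

open Literature.MathematicalPhysics.QuantumFieldTheory.Balaban1983to89
open T4Continuum BlockAveraging ExpMeanLog
open Literature.MathematicalPhysics.QuantumFieldTheory.Balaban1983to89.BlockAveragingSectionAction (iterSec)
open Literature.MathematicalPhysics.QuantumFieldTheory.Balaban1983to89.B5Eq118OneStroke (iterBlockOf)
open Literature.MathematicalPhysics.QuantumFieldTheory.Balaban1983to89.B10Eq38TorusDomains (toFine plaqsIn)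
open Literature.MathematicalPhysics.QuantumFieldTheory.Balaban1983to89.B10Eq42TorusConstraint (bondsIn)
open Literature.MathematicalPhysics.QuantumFieldTheory.Balaban1983to89.T3ContinuumYM3Torus (T3Family)
open Summit.QuantumFields.Balaban3D.Carriers
open Summit.QuantumFields.YangMills.Theorems.ModelBox
open Summit.QuantumFields.YangMills.Theorems.PerturbedPlaquette (dist1_SU_eq)
open Summit.QuantumFields.YangMills.Theorems.StartDefectBox (twoCellSet)
open Summit.QuantumFields.YangMills.Theorems.AvgIterLocality (coarsen_eq_iterBlockOf)

/-! ## §1 d = 3 bookkeeping: the longitudinal direction -/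

/-- The third direction of `Fin 3`. [folklore] -/
def thirdDir (μ ν : Fin 3) : Fin 3 := ⟨(3 - (μ.val + ν.val)) % 3, Nat.mod_lt _ (by norm_num)⟩

/-- For `μ ≠ ν` in `Fin 3`, `j ∉ {μ, ν} ↔ j = thirdDir μ ν`. [folklore] -/
theorem thirdDir_spec : ∀ μ ν j : Fin 3, μ ≠ ν → (¬ (j = μ ∨ j = ν) ↔ j = thirdDir μ ν) := by decide

/-! ## §2 The log window from the data -/

section Window

variable {P : Params} {n : Type*} [Fintype n] [DecidableEq n] [Nonempty n] (k : ℕ) (Ω : Set (Site P 0)) (V : GaugeField P k (Matrix.specialUnitaryGroup n ℂ))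

/-- The window row `hwin` of ★w2's lattice theorems from `dist1 V(∂Q) ≤ ε′ ≤ 1∕4`, `|n|·ε′ < π`. [cite: Balaban1985Variational, (15) p.280] -/
theorem hwin_of_dist1 {ε' : ℝ} (hV : ∀ Q, Q ∈ plaqsIn k Ω → GaugeGroup.dist1 (GaugeField.plaqHol V Q) ≤ ε') (hε4 : ε' ≤ 1 / 4) (hnπ : (Fintype.card n : ℝ) * ε' < Real.pi) :
    ∀ Q : Plaq P k, Q ∈ plaqsIn k Ω → ‖((wordQ k V Q : Matrix.specialUnitaryGroup n ℂ) : Matrix n n ℂ) - 1‖ ≤ 1 / 4 ∧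
      (Fintype.card n : ℝ) * ‖((wordQ k V Q : Matrix.specialUnitaryGroup n ℂ) : Matrix n n ℂ) - 1‖ < Real.pi := by
  intro Q hQ
  have hd : ‖((wordQ k V Q : Matrix.specialUnitaryGroup n ℂ) : Matrix n n ℂ) - 1‖ ≤ ε' := by
    rw [← dist1_SU_eq, wordQ_eq_inv, GaugeGroup.dist1_inv]; exact hV Q hQ
  exact ⟨hd.trans hε4, lt_of_le_of_lt (mul_le_mul_of_nonneg_left hd (Nat.cast_nonneg _)) hnπ⟩

end Window

/-! ## §3 The certificate at `Ω_{k+1}(h)` -/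

section Cert

variable (F : T3Family) (K : ℕ) {n : Type*} [Fintype n] [DecidableEq n] [Nonempty n] (k : ℕ) (M₁ : ℕ) (Rcol : ℕ → ℕ) (h : Hist (F.P K) (k + 1))
  (V : GaugeField (F.P K) k (Matrix.specialUnitaryGroup n ℂ))

open Classical in
/-- **★★★ THE START CERTIFICATE AT `Ω_{k+1}(h)`, ALL LATTICE BINDERS KNITTED IN**: (P) and (D) of `startT3_cert` at `Ω := Omega M₁ Rcol (k+1) h (k+1)`, displaying only the two numeral
windows `ε′ ≤ 10⁻⁵` and `10²²·L·ε′ ≤ 1`. [cite: Balaban1985Variational, Thm 1 (8) p.279, (11)–(15) pp.279–280] -/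
theorem startT3_cert_omega (hkK : k + 1 ≤ (F.P K).m + (F.P K).K) (hm : 16 ≤ (F.P K).L ^ k) (hN4 : 4 * (F.P K).L ^ k ≤ (F.P K).sitesPerDir 0) (hn2 : Fintype.card n = 2)
    {ε' : ℝ} (hε0 : 0 ≤ ε') (hε5 : ε' ≤ 1 / 100000)
    (hV : ∀ Q, Q ∈ plaqsIn k (Omega M₁ Rcol (k + 1) h (k + 1)) → GaugeGroup.dist1 (GaugeField.plaqHol V Q) ≤ ε')
    (hεS : (10 : ℝ) ^ 22 * (F.L : ℝ) * ε' ≤ 1) :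
    (∀ q : Plaq (F.P K) 0, q ∈ plaqsIn 0 (Omega M₁ Rcol (k + 1) h (k + 1)) →
      GaugeGroup.dist1 (GaugeField.plaqHol (startT3 F K k (Omega M₁ Rcol (k + 1) h (k + 1)) V (tubeBd F K k ε')) q) ≤ startBd F K k ε') ∧
    (∀ c : PBond (F.P K) k, c ∈ bondsIn k (Omega M₁ Rcol (k + 1) h (k + 1)) →
      ‖((Averaging.iter (fun i => (blockAvg (expMeanLogSU (n := n)) : Averaging (F.P K) i (Matrix.specialUnitaryGroup n ℂ))) k
            (startT3 F K k (Omega M₁ Rcol (k + 1) h (k + 1)) V (tubeBd F K k ε')) c : Matrix.specialUnitaryGroup n ℂ) : Matrix n n ℂ) *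
          star ((V c : Matrix.specialUnitaryGroup n ℂ) : Matrix n n ℂ) - 1‖ ≤
        2 * ((((F.P K).d : ℝ) + 1) * ((F.P K).L : ℝ) ^ k * (((((F.P K).d * ((F.P K).L ^ k / 2) + (F.P K).L ^ k : ℕ)) : ℝ) * startBd F K k ε'))) := by
  set Ω : Set (Site (F.P K) 0) := Omega M₁ Rcol (k + 1) h (k + 1) with hΩ
  have hk : k ≤ (F.P K).m + (F.P K).K := by omega
  -- saturation rows at `Ω_{k+1}(h)`
  have hsat : ∀ x x' : Site (F.P K) 0, coarsen k x = coarsen k x' → (x ∈ Ω ↔ x' ∈ Ω) := fun x x' hxx =>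
    mem_Omega_iff_of_coarsen_eq M₁ Rcol h (Nat.le_succ k) le_rfl hxx
  have htf : ∀ z : Site (F.P K) k, coarsen k (toFine k z) = z := fun z => coarsen_toFine k hk z
  have hsat1 := omega_sat1 M₁ Rcol hk h
  have hsatI : ∀ x : Site (F.P K) 0, x ∈ Ω ↔ toFine k (iterBlockOf k x) ∈ Ω := fun x => omega_sat M₁ Rcol hk h x
  -- d = 3
  have hd3 : (F.P K).d = 3 := T3Family.P_d F K
  let lam : Plaq (F.P K) k → Fin (F.P K).d := fun Q => thirdDir Q.μ Q.ν
  have hlam : ∀ (Q : Plaq (F.P K) k) (j : Fin (F.P K).d), ¬ (j = Q.μ ∨ j = Q.ν) ↔ j = lam Q := fun Q j => thirdDir_spec Q.μ Q.ν j (ne_of_lt Q.hμν)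
  -- the window
  have hε4 : ε' ≤ 1 / 4 := by linarith
  have hnπ : (Fintype.card n : ℝ) * ε' < Real.pi := by rw [hn2]; push_cast; linarith [Real.pi_gt_three]
  have hwin := hwin_of_dist1 k Ω V hV hε4 hnπ
  have hNk : (F.P K).sitesPerDir 0 = (F.P K).sitesPerDir k * (F.P K).L ^ k := Prop7FlatHolonomy.sitesPerDir_zero_eq_mul_pow hk
  have hS6 := S6rows_of_le F K k hn2 hm hε0 hεS
  exact startT3_cert F K k Ω V hk hm hN4 hn2 hε0 hε5 hV (hbox_canon Ω V hkK hsat htf hsat1 lam hlam hm hN4 hwin)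
    (hsep_canon Ω V hkK hsat htf hsat1 lam hlam hm hN4 hNk hwin) (hcov_canon Ω V hk hsat htf hm hN4 hwin)
    (hbox_shell Ω V hkK hsat htf hsat1 hsatI lam hlam hm hN4 hNk hwin) (hsep_shell Ω V hkK hsat htf hsat1 hsatI lam hlam hm hN4 hNk hwin)
    (hcov_shell Ω V hk hsat htf hsatI hm hN4 hwin) (htwo_of_sat hk hsatI) hS6.1 hS6.2.1 hS6.2.2

end Cert

end Summit.QuantumFields.YangMills.Theorems.TubeStart

end
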